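import Summits.MatrixMultiplication.MatrixMultiplication.Theorems.SaturationLadderFlatFormats
import HarnessLib

/-!
# Route `SaturationLadder` — the TRANSFER LAW of exact certificates between matrix multiplication formats
(decomp-mm lens 1 «grading / quantitative ladder», gen 27; route-free helper: imports NO `Theses` file)

Gens 25–26 priced a certificate `T^{⊗N} ⊵ ⟨t⟩ ⊗ ⟨q^a,q^b,q^c⟩` by the three gauge floors and read the route's items as
FLAT-TO-FLAT TRANSFERS between matrix multiplication formats (`E_k ⟺ ⟨p^k,p,p⟩ flat`; `TailDescentTwo`,
`SquareFromTwo`, the summit = transfers `⟨p^k,p,p⟩ → ⟨p²,p,p⟩ → ⟨p,p,p⟩`; the crux `SubexpSaturation` = thin formats flat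
at subexponential length).  Here the ONE lossless transfer engine the tree has — an EXACT single-base certificate
(`U := (N·ω(a',b',c')·log p − log t)/log q ≤ a + c`) from a power of a format `⟨p^{a'},p^{b'},p^{c'}⟩` — is shown to act
MONOTONICALLY on formats.  With `ρ := N log p/log q` the three packings (`t·q^{s_i} ≤ p^{N s'_i}` at the gauge points
`ζ⁽¹⁾,ζ⁽²⁾,ζ⁽³⁾ ∈ Δ`, pair sums `s = (a+c, a+b, b+c)`; Strassen's spectrum of matrix multiplication, CLLZ 2020 Lemma 4.1)
and exactness confine `ρ` to the interval `max_i s_i/s'_i ≤ ρ ≤ min((a−b)/(a'−b'), (c−b)/(c'−b'))` (§2: the output-leg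
packing is SATURATED, `t·q^{a+c} = p^{N(a'+c')}`; the base is tight; the target is inner-bound `b ≤ min(a,c)`), whence
six bilinear LAWS in `ℕ` (§2): **`b·a' ≤ a·b'`** (the ratio `a/b` never decreases), **`b·c' ≤ c·b'`** (`c/b` never
decreases), `(a'+c')·b ≤ (a+c)·b'`, and the excess laws `(a'−b')(a+c) ≤ (a−b)(a'+c')`, `(c'−b')(a+c) ≤ (c−b)(a'+c')`,
`(c'−b')(a+b) ≤ (c−b)(a'+b')`, `(a'−b')(b+c) ≤ (a−b)(b'+c')`.
Chain file 2 (`…TransferLawRigidity`, route-free): RIGIDITY OF THE ONSET LADDER under this engine — an exact certificate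
for an inner-square target `⟨q^{jb},q^b,q^b⟩` has a base with `c' = b'`, `a' ≤ j·b'`, tight, a format that ALREADY proves `E_j`
by padding; cube targets need tight cube bases; a far base `⟨p^k,p,p⟩` certifies along the far edge only `U ≥ b·ω(k,1,1)`:
single-base transfer never LOWERS the onset number, so `TailDescentTwo` (29474), `SquareFromTwo` (29475) and every onset
rung lie outside the class (the typed obstruction asked for by the critic, g26 r3); and the LENGTH FLOOR
`log 4 · b/(a−b) ≤ log((a+c)/b) + 1 − log 2` propagates along exact transfers.  Chain file 3 (`…TransferLawItems`) feeds
it the X-perfect catalogue (in-class saturation constant `log 4`) and reads the route's items by name.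
Placement: the inequalities are the vertex functionals of the catalogued `RectangularBarrier` (CLLZ 2020 Thm. 3.10, Lemma 4.1:
`ζ^θ(⟨a,b,c⟩) = a^{θ₁+θ₃} b^{θ₁+θ₂} c^{θ₂+θ₃}` is log-linear in `θ`, so the three vertices imply the whole segment) used as a
resource on the route's own currency; new is the exactness packaging (format monotonicity, onset rigidity).  Support module
beneath stmt-MatrixMultiplication-25909; closes no item; 0 sorry; no definitions; imports only BUILT modules.
[cite: ChristandlLeGallLysikovZuiddam2020, Thm. 3.10, eq. (5) and Lemma 4.1; Strassen1988, §3; AlmanLi2026, Prop. 4.1 and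
Prop. 4.2; ChristandlVranaZuiddam2023, Example 1.4; AlmanDuanVassilevskaWilliamsXuXuZhou2025, §3.4 and Thm. 3.2;
LottiRomani1983, §1 (p. 173)]
-/

set_option linter.dupNamespace false

noncomputable section

open scoped BigOperators

namespace Summit.MatrixMultiplication.MatrixMultiplication.Theorems.SaturationLadderTransferLaw

open Literature.Computability.AlgebraicComplexity
open Literature.Barriers.MatrixMultiplication
open Summit.MatrixMultiplication.MatrixMultiplication.Theorems.SaturationLadderSpectralFloor
  (gauge₁_packing_le gauge₂_packing_le gauge₃_packing_le)  -- landed, imported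
open Summit.MatrixMultiplication.MatrixMultiplication.Theorems.SaturationLadderFlatFormats
  (flatteningRank_matMulTensor_rect)  -- landed, imported

variable {K : Type} [Field K]

/-! ## 1. The three packings of a certificate between formats, in logarithms -/

section Legs

/-- Real-arithmetic core: `t ≥ 1`, `q ≥ 2`, `t · q^s ≤ (p^{s'})^N` ⟹ `log t + s·log q ≤ N·(s'·log p)`. [folklore] -/
theorem log_of_packing {t q p s s' N : ℕ} (ht : 1 ≤ t) (hq : 2 ≤ q)
    (hpack : (t : ℝ) * (q : ℝ) ^ s ≤ ((p : ℝ) ^ s') ^ N) :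
    Real.log t + (s : ℝ) * Real.log q ≤ (N : ℝ) * ((s' : ℝ) * Real.log p) := by
  have ht0 : (0 : ℝ) < t := by exact_mod_cast (by omega : 0 < t)
  have hq0 : (0 : ℝ) < q := by exact_mod_cast (by omega : 0 < q)
  have hqs : (0 : ℝ) < (q : ℝ) ^ s := pow_pos hq0 s
  have hlog := Real.log_le_log (mul_pos ht0 hqs) hpack
  rw [Real.log_mul ht0.ne' hqs.ne', Real.log_pow, Real.log_pow, Real.log_pow] at hlog
  linarith

variable {p a' b' c' N t q a b c : ℕ}

/-- **Output-leg packing** `t·q^{a+c} ≤ ζ⁽¹⁾(⟨p^{a'},p^{b'},p^{c'}⟩)^N = p^{N(a'+c')}`, in logarithms.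
[cite: ChristandlVranaZuiddam2023, Example 1.4; ChristandlLeGallLysikovZuiddam2020, Lemma 4.1] -/
theorem logPacking₁ (hp : 2 ≤ p) (hq : 2 ≤ q) (ht : 1 ≤ t)
    (h : PolyDegeneratesTo (kroneckerPow (matMulTensor K (p ^ a') (p ^ b') (p ^ c')) N)
      (kroneckerTensor (unitTensor K t) (matMulTensor K (q ^ a) (q ^ b) (q ^ c)))) :
    Real.log t + ((a + c : ℕ) : ℝ) * Real.log q ≤ (N : ℝ) * (((a' + c' : ℕ) : ℝ) * Real.log p) := by
  have hpack := gauge₁_packing_le _ N t (q ^ a) (q ^ b) (q ^ c) (pow_pos (by omega) b) h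
  rw [flatteningRank_matMulTensor_rect (K := K) (by omega) a' b' c'] at hpack
  have he : (((q ^ a * q ^ c : ℕ)) : ℝ) = (q : ℝ) ^ (a + c) := by push_cast; ring
  rw [he] at hpack
  exact log_of_packing ht hq hpack

/-- **First-input-leg packing** `t·q^{a+b} ≤ ζ⁽²⁾(⟨p^{a'},p^{b'},p^{c'}⟩)^N = p^{N(a'+b')}`, in logarithms.
[cite: ChristandlVranaZuiddam2023, Example 1.4; ChristandlLeGallLysikovZuiddam2020, Lemma 4.1] -/
theorem logPacking₂ (hp : 2 ≤ p) (hq : 2 ≤ q) (ht : 1 ≤ t)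
    (h : PolyDegeneratesTo (kroneckerPow (matMulTensor K (p ^ a') (p ^ b') (p ^ c')) N)
      (kroneckerTensor (unitTensor K t) (matMulTensor K (q ^ a) (q ^ b) (q ^ c)))) :
    Real.log t + ((a + b : ℕ) : ℝ) * Real.log q ≤ (N : ℝ) * (((a' + b' : ℕ) : ℝ) * Real.log p) := by
  have hpack := gauge₂_packing_le _ N t (q ^ a) (q ^ b) (q ^ c) (pow_pos (by omega) c) h
  rw [gaugePoint₂_matMulTensor (K := K) (pow_pos (by omega) c')] at hpack
  have he : (((q ^ a * q ^ b : ℕ)) : ℝ) = (q : ℝ) ^ (a + b) := by push_cast; ring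
  have he' : (((p ^ a' * p ^ b' : ℕ)) : ℝ) = (p : ℝ) ^ (a' + b') := by push_cast; ring
  rw [he, he'] at hpack
  exact log_of_packing ht hq hpack

/-- **Second-input-leg packing** `t·q^{b+c} ≤ ζ⁽³⁾(⟨p^{a'},p^{b'},p^{c'}⟩)^N = p^{N(b'+c')}`, in logarithms.
[cite: ChristandlVranaZuiddam2023, Example 1.4; ChristandlLeGallLysikovZuiddam2020, Lemma 4.1] -/
theorem logPacking₃ (hp : 2 ≤ p) (hq : 2 ≤ q) (ht : 1 ≤ t)
    (h : PolyDegeneratesTo (kroneckerPow (matMulTensor K (p ^ a') (p ^ b') (p ^ c')) N)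
      (kroneckerTensor (unitTensor K t) (matMulTensor K (q ^ a) (q ^ b) (q ^ c)))) :
    Real.log t + ((b + c : ℕ) : ℝ) * Real.log q ≤ (N : ℝ) * (((b' + c' : ℕ) : ℝ) * Real.log p) := by
  have hpack := gauge₃_packing_le _ N t (q ^ a) (q ^ b) (q ^ c) (pow_pos (by omega) a) h
  rw [gaugePoint₃_matMulTensor (K := K) (pow_pos (by omega) a')] at hpack
  have he : (((q ^ c * q ^ b : ℕ)) : ℝ) = (q : ℝ) ^ (b + c) := by push_cast; ring
  have he' : (((p ^ c' * p ^ b' : ℕ)) : ℝ) = (p : ℝ) ^ (b' + c') := by push_cast; ring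
  rw [he, he'] at hpack
  exact log_of_packing ht hq hpack

end Legs

/-! ## 2. Exact certificates: the saturated packing, the interval for `ρ = N log p/log q`, the laws -/

/-- Real core of the laws: `0 < L`, `0 ≤ e`, `0 ≤ S`, `P·L ≤ S·Y`, `e·Y ≤ s·L` ⟹ `e·P ≤ S·s`. [folklore] -/
theorem bilinear_of_interval {L Y e s P S : ℝ} (hL : 0 < L) (he : 0 ≤ e) (hS : 0 ≤ S)
    (hP : P * L ≤ S * Y) (hE : e * Y ≤ s * L) : e * P ≤ S * s := by
  have h1 : e * P * L ≤ e * (S * Y) := by nlinarith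
  have h2 : S * (e * Y) ≤ S * (s * L) := mul_le_mul_of_nonneg_left hE hS
  exact le_of_mul_le_mul_right (by nlinarith) hL

section Exact

variable {p a' b' c' N t q a b c : ℕ} (hp : 2 ≤ p) (hq : 2 ≤ q) (ht : 1 ≤ t)
  (h : PolyDegeneratesTo (kroneckerPow (matMulTensor K (p ^ a') (p ^ b') (p ^ c')) N)
    (kroneckerTensor (unitTensor K t) (matMulTensor K (q ^ a) (q ^ b) (q ^ c))))
  (hac : 1 ≤ a + c)
  (hU : ((N : ℝ) * (omegaRect K a' b' c' * Real.log p) - Real.log t) / Real.log q ≤ ((a + c : ℕ) : ℝ))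
include hp hq ht h hac hU

/-- **The linear skeleton of an exact certificate** (`U ≤ a + c`, `a + c ≥ 1`): with `Y = N log p > 0`,
`L = log q > 0` — the base is tight, the output-leg packing is saturated (`log t + (a+c)L = (a'+c')Y`), and
`(a'−b')Y ≤ (a−b)L`, `(c'−b')Y ≤ (c−b)L`, `(a+b)L ≤ (a'+b')Y`, `(b+c)L ≤ (b'+c')Y`.
[cite: ChristandlLeGallLysikovZuiddam2020, Thm. 3.10 and Lemma 4.1; LottiRomani1983, §1 (p. 173)] -/
theorem exact_skeleton :
    omegaRect K a' b' c' = ((a' + c' : ℕ) : ℝ) ∧ 0 < (N : ℝ) * Real.log p ∧ 0 < Real.log q ∧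
    Real.log t + ((a : ℝ) + c) * Real.log q = ((a' : ℝ) + c') * ((N : ℝ) * Real.log p) ∧
    ((a' : ℝ) - b') * ((N : ℝ) * Real.log p) ≤ ((a : ℝ) - b) * Real.log q ∧
    ((c' : ℝ) - b') * ((N : ℝ) * Real.log p) ≤ ((c : ℝ) - b) * Real.log q ∧
    ((a : ℝ) + b) * Real.log q ≤ ((a' : ℝ) + b') * ((N : ℝ) * Real.log p) ∧
    ((b : ℝ) + c) * Real.log q ≤ ((b' : ℝ) + c') * ((N : ℝ) * Real.log p) := by
  have hq1 : (1 : ℝ) < q := by exact_mod_cast (by omega : 1 < q)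
  have hL : 0 < Real.log q := Real.log_pos hq1
  have hp1 : (1 : ℝ) < p := by exact_mod_cast (by omega : 1 < p)
  have hlogp : 0 < Real.log p := Real.log_pos hp1
  have ht1 : (1 : ℝ) ≤ t := by exact_mod_cast ht
  have hlogt : 0 ≤ Real.log t := Real.log_nonneg ht1
  have hN0 : (0 : ℝ) ≤ N := Nat.cast_nonneg N
  have hacR : (1 : ℝ) ≤ (a : ℝ) + c := by exact_mod_cast hac
  have l1 := logPacking₁ (K := K) hp hq ht h
  have l2 := logPacking₂ (K := K) hp hq ht h
  have l3 := logPacking₃ (K := K) hp hq ht h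
  have hUL := (div_le_iff₀ hL).1 hU
  have hω := add_le_omegaRect₁₃ K (a' : ℝ) b' c'
  push_cast at l1 l2 l3 hUL hω
  -- `N ≥ 1`: the right-hand side of the output-leg packing is positive
  have hN1 : (1 : ℝ) ≤ N := by
    by_contra hN
    have hN0' : (N : ℝ) = 0 := by
      have : N = 0 := by
        by_contra h0
        exact hN (by exact_mod_cast Nat.one_le_iff_ne_zero.2 h0)
      simp [this]
    rw [hN0'] at l1
    nlinarith
  have hY : 0 < (N : ℝ) * Real.log p := by nlinarith
  -- `ω'·Y ≤ (a'+c')·Y` from exactness and the output-leg packing, hence tightness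
  have hωY : (N : ℝ) * Real.log p * omegaRect K a' b' c' ≤ (N : ℝ) * Real.log p * ((a' : ℝ) + c') := by
    nlinarith
  have hT' : omegaRect K a' b' c' ≤ (a' : ℝ) + c' := le_of_mul_le_mul_left hωY hY
  have hT : omegaRect K a' b' c' = (a' : ℝ) + c' := le_antisymm hT' hω
  rw [hT] at hUL
  refine ⟨by push_cast; exact hT, hY, hL, by linarith, by linarith, by linarith, by linarith, by linarith⟩

/-- **An exact certificate needs a TIGHT base** `ω(a',b',c') = a' + c'` (gen 26 `base_tight_of_exact`, here without
the side condition `a' + c' ≥ 1`) — and hence an inner-bound base, `b' ≤ a'`, `b' ≤ c'`. [cite: LottiRomani1983, §1 (p. 173)] -/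
theorem exact_base_tight :
    omegaRect K a' b' c' = ((a' + c' : ℕ) : ℝ) ∧ b' ≤ a' ∧ b' ≤ c' := by
  obtain ⟨hT, -, -, -, -, -, -, -⟩ := exact_skeleton hp hq ht h hac hU
  have h12 := add_le_omegaRect₁₂ K (a' : ℝ) b' c'
  have h23 := add_le_omegaRect₂₃ K (a' : ℝ) b' c'
  rw [hT] at h12 h23
  push_cast at h12 h23
  exact ⟨hT, by exact_mod_cast (by linarith : (b' : ℝ) ≤ a'), by exact_mod_cast (by linarith : (b' : ℝ) ≤ c')⟩

/-- **Exactness saturates the output-leg packing**: `log t + (a+c)·log q = N·(a'+c')·log p`, i.e.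
`t · q^{a+c} = ζ⁽¹⁾(base)^N` — an exact certificate uses every unit of output-leg flattening rank.
[cite: ChristandlLeGallLysikovZuiddam2020, Thm. 3.10] -/
theorem exact_packing₁_eq :
    Real.log t + ((a : ℝ) + c) * Real.log q = ((a' : ℝ) + c') * ((N : ℝ) * Real.log p) :=
  (exact_skeleton hp hq ht h hac hU).2.2.2.1

/-- **The target of an exact certificate is inner-bound**: `b ≤ a` and `b ≤ c` (critic g26 r1: «flat» is
output-leg flatness; here it is a CONSEQUENCE of exactness, for base and target alike). [cite: LottiRomani1983, §1 (p. 173)] -/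
theorem exact_target_inner_le : b ≤ a ∧ b ≤ c := by
  obtain ⟨-, hY, hL, -, e3, e2, -, -⟩ := exact_skeleton hp hq ht h hac hU
  obtain ⟨-, hba', hbc'⟩ := exact_base_tight hp hq ht h hac hU
  have hba'R : (b' : ℝ) ≤ a' := by exact_mod_cast hba'
  have hbc'R : (b' : ℝ) ≤ c' := by exact_mod_cast hbc'
  have h1 : 0 ≤ ((a : ℝ) - b) * Real.log q := le_trans (mul_nonneg (by linarith) hY.le) e3
  have h2 : 0 ≤ ((c : ℝ) - b) * Real.log q := le_trans (mul_nonneg (by linarith) hY.le) e2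
  have h1' : (0 : ℝ) ≤ (a : ℝ) - b := nonneg_of_mul_nonneg_left h1 hL
  have h2' : (0 : ℝ) ≤ (c : ℝ) - b := nonneg_of_mul_nonneg_left h2 hL
  exact ⟨by exact_mod_cast (by linarith : (b : ℝ) ≤ a), by exact_mod_cast (by linarith : (b : ℝ) ≤ c)⟩

/-- **THINNESS LAW** `b·a' ≤ a·b'`: the ratio `a/b` of the target is at least that of the base — exact transfer
never makes a format thinner-sided on `a` (from the `ζ⁽²⁾`-packing and the `ζ⁽³⁾`-exactness bound).
[cite: ChristandlLeGallLysikovZuiddam2020, Thm. 3.10 and Lemma 4.1] -/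
theorem exact_thinness_law : b * a' ≤ a * b' := by
  obtain ⟨-, -, hL, -, e3, -, p2, -⟩ := exact_skeleton hp hq ht h hac hU
  obtain ⟨-, hba', -⟩ := exact_base_tight hp hq ht h hac hU
  have hba'R : (b' : ℝ) ≤ a' := by exact_mod_cast hba'
  have key := bilinear_of_interval hL (by linarith) (by positivity) p2 e3
  have : (b : ℝ) * a' ≤ (a : ℝ) * b' := by nlinarith
  exact_mod_cast this

/-- **LENGTH LAW** `b·c' ≤ c·b'`: the ratio `c/b` of the target is at least that of the base.
[cite: ChristandlLeGallLysikovZuiddam2020, Thm. 3.10 and Lemma 4.1] -/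
theorem exact_length_law : b * c' ≤ c * b' := by
  obtain ⟨-, -, hL, -, -, e2, -, p3⟩ := exact_skeleton hp hq ht h hac hU
  obtain ⟨-, -, hbc'⟩ := exact_base_tight hp hq ht h hac hU
  have hbc'R : (b' : ℝ) ≤ c' := by exact_mod_cast hbc'
  have key := bilinear_of_interval hL (by linarith) (by positivity) p3 e2
  have : (b : ℝ) * c' ≤ (c : ℝ) * b' := by nlinarith
  exact_mod_cast this

/-- **OUTER LAW** `(a'+c')·b ≤ (a+c)·b'`: the normalised outer length `(a+c)/b` never decreases. [cite: ChristandlLeGallLysikovZuiddam2020, Thm. 3.10] -/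
theorem exact_outer_law : (a' + c') * b ≤ (a + c) * b' := by
  have h1 := exact_thinness_law hp hq ht h hac hU
  have h2 := exact_length_law hp hq ht h hac hU
  nlinarith

/-- **EXCESS LAW on `a`**: `(a'−b')(a+c) ≤ (a−b)(a'+c')`, stated in `ℕ` without subtraction (the `ζ⁽³⁾`-floor under
exactness). [cite: ChristandlLeGallLysikovZuiddam2020, Thm. 3.10 and Lemma 4.1] -/
theorem exact_excess_law₁ : a' * (a + c) + b * (a' + c') ≤ a * (a' + c') + b' * (a + c) := by
  obtain ⟨-, hY, hL, q1, e3, -, -, -⟩ := exact_skeleton hp hq ht h hac hU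
  obtain ⟨-, hba', -⟩ := exact_base_tight hp hq ht h hac hU
  have hba'R : (b' : ℝ) ≤ a' := by exact_mod_cast hba'
  have ht1 : (1 : ℝ) ≤ t := by exact_mod_cast ht
  have hlogt : 0 ≤ Real.log t := Real.log_nonneg ht1
  have p1 : ((a : ℝ) + c) * Real.log q ≤ ((a' : ℝ) + c') * ((N : ℝ) * Real.log p) := by linarith
  have key := bilinear_of_interval hL (by linarith) (by positivity) p1 e3
  have : (a' : ℝ) * (a + c) + b * (a' + c') ≤ (a : ℝ) * (a' + c') + b' * (a + c) := by nlinarith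
  exact_mod_cast this

/-- **EXCESS LAW on `c`**: `(c'−b')(a+c) ≤ (c−b)(a'+c')` (the `ζ⁽²⁾`-floor under exactness).
[cite: ChristandlLeGallLysikovZuiddam2020, Thm. 3.10 and Lemma 4.1] -/
theorem exact_excess_law₃ : c' * (a + c) + b * (a' + c') ≤ c * (a' + c') + b' * (a + c) := by
  obtain ⟨-, hY, hL, q1, -, e2, -, -⟩ := exact_skeleton hp hq ht h hac hU
  obtain ⟨-, -, hbc'⟩ := exact_base_tight hp hq ht h hac hU
  have hbc'R : (b' : ℝ) ≤ c' := by exact_mod_cast hbc'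
  have ht1 : (1 : ℝ) ≤ t := by exact_mod_cast ht
  have hlogt : 0 ≤ Real.log t := Real.log_nonneg ht1
  have p1 : ((a : ℝ) + c) * Real.log q ≤ ((a' : ℝ) + c') * ((N : ℝ) * Real.log p) := by linarith
  have key := bilinear_of_interval hL (by linarith) (by positivity) p1 e2
  have : (c' : ℝ) * (a + c) + b * (a' + c') ≤ (c : ℝ) * (a' + c') + b' * (a + c) := by nlinarith
  exact_mod_cast this

/-- **MIXED LAWS**: `(c'−b')(a+b) ≤ (c−b)(a'+b')` and `(a'−b')(b+c) ≤ (a−b)(b'+c')`.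
[cite: ChristandlLeGallLysikovZuiddam2020, Thm. 3.10 and Lemma 4.1] -/
theorem exact_mixed_laws :
    c' * (a + b) + b * (a' + b') ≤ c * (a' + b') + b' * (a + b) ∧
    a' * (b + c) + b * (b' + c') ≤ a * (b' + c') + b' * (b + c) := by
  obtain ⟨-, hY, hL, -, e3, e2, p2, p3⟩ := exact_skeleton hp hq ht h hac hU
  obtain ⟨-, hba', hbc'⟩ := exact_base_tight hp hq ht h hac hU
  have hba'R : (b' : ℝ) ≤ a' := by exact_mod_cast hba'
  have hbc'R : (b' : ℝ) ≤ c' := by exact_mod_cast hbc'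
  have k1 := bilinear_of_interval hL (by linarith) (by positivity) p2 e2
  have k2 := bilinear_of_interval hL (by linarith) (by positivity) p3 e3
  have h1 : (c' : ℝ) * (a + b) + b * (a' + b') ≤ (c : ℝ) * (a' + b') + b' * (a + b) := by nlinarith
  have h2 : (a' : ℝ) * (b + c) + b * (b' + c') ≤ (a : ℝ) * (b' + c') + b' * (b + c) := by nlinarith
  exact ⟨by exact_mod_cast h1, by exact_mod_cast h2⟩

end Exact

end Summit.MatrixMultiplication.MatrixMultiplication.Theorems.SaturationLadderTransferLaw

end
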